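import Summits.QuantumFields.YangMills.Theorems.UnitScaleTiltFluctuationComparisonRegPrLiftLegsKernel
import Summits.QuantumFields.YangMills.Theorems.UnitScaleTiltFluctuationComparisonRegPrLiftFaceAssembly

/-!
# Route `UnitScaleTilt` — crux K1bR-pr `FluctuationComparisonRegPr` (stmt-QuantumFields-19201 → `…L`), stub `stub_oneStepSmallLift`, piece (L2)
# for INTERIOR-SUPPORTED kernels — the Γ-LEG LAYER, file 6: `ApproxSmallLift` AND THE PER-`L` CLAUSE FROM A LINE-NEUTRAL KERNEL TABLE
# (support file `--supports stmt-QuantumFields-19201`)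

Cell `ym3-torus` (HUMAN RULING D-0037, YM ladder rung R3), seat `ym3-torus-p1` gen 11 (UV side; cell memo HOME/UV3-NODE.md §20).  The fleet's
assembly `…LiftFaceAssembly.exists_approxSmallLift_of_kernel` (★ym-ust-19201-p1 g2, p478011) closes the per-`L` hypothesis of
`oneStepSmallLift_stub_of_approx` from a kernel table with `FaceSupported ∧ SNeutral ∧ RowMass ∧ RowBound`.  Its PLAQUETTE clause
(`dist1_plaqHol_kernelLift_le`, `plaqBound_le_budget`) never used the face support; its ACCURACY clause did (F1/F2).  With the Γ-leg layer
(files 1–5: `approxLiftStep_of_lineNeutral`) the accuracy clause holds for ANY table whose LINE FORM vanishes.  Hence, verbatim in the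
fleet's shapes with `FaceSupported ∧ SNeutral` replaced by `LineNeutral`:

* `approxLiftStep_of_kernel_lineNeutral` — `ApproxLiftStep P j (λ + (Cq+1)δ₀) (Ca·δ²) δ` for `0 < δ ≤ δ₀ ≤ 1/3`, `320·m·K₁·δ₀ ≤ 1`;
* `approxSmallLift_of_kernel_lineNeutral` — the family schema;
* **`exists_approxSmallLift_of_kernel_lineNeutral`** — THE PER-`L` CLAUSE: a table over `Fin 3 → Fin L` with `LineNeutral ∧ RowMass K₁ ∧ RowBound λ β`
  at every run and `λ√L < 1` gives `∃ κ₀ C δ₀, 0 ≤ κ₀ ∧ κ₀√L < 1 ∧ 0 ≤ C ∧ 0 < δ₀ ∧ ∀ F, F.L = L → ApproxSmallLift F κ₀ C δ₀`.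

So an INTERIOR-supported certificate (this lineage's dual Whitney lift, ‖R₂‖ = 8L⁴/(L²+1)³ < L^{-1/2} for every odd L ≥ 5, p473948–p476131;
p2 g9's tensor homotopy) closes `stub_oneStepSmallLift` at `L` once typed as a tree-coordinate table with these three finite properties — no
face support, no separate Γ-leg work left.  Elementary; nothing of Bałaban's is asserted.
-/

noncomputable section

open scoped BigOperators

namespace Summit.QuantumFields.YangMills.Theorems.ApproxLift

open Literature.MathematicalPhysics.QuantumFieldTheory.Balaban1983to89
open T4Continuum BlockAveraging AveragingRT B10Eq47AxialChi BlockAveragingSection BlockAveragingSectionPlaq ExpMeanLog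
open Literature.MathematicalPhysics.QuantumFieldTheory.Balaban1983to89.T3ContinuumYM3Torus

variable {P : Params} {j : ℕ}

/-! ## §1 The accuracy constant -/

/-- **THE ACCURACY CONSTANT** of a line-neutral kernel lift: `Ca = 477·(4mK₁)² + L·(8K₁² + K₁·uq)`, `m = (d+3)L`. -/
def Ca (P : Params) (R : ℕ) (K₁ : ℝ) : ℝ := 477 * (4 * (legLen P : ℝ) * K₁) ^ 2 + (P.L : ℝ) * (8 * K₁ ^ 2 + K₁ * uq P R)

/-- `0 ≤ Ca` for `K₁ ≥ 0`. -/
theorem Ca_nonneg (P : Params) (R : ℕ) {K₁ : ℝ} (hK : 0 ≤ K₁) : 0 ≤ Ca P R K₁ := by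
  unfold Ca uq; positivity

/-! ## §2 The approximate lift step and the family schema from a line-neutral kernel -/

/-- **`ApproxLiftStep` FROM A LINE-NEUTRAL KERNEL** (`SU(2)`): a table with `LineNeutral`, row mass `≤ K₁` and the row bound `(λ, β)` gives, for
`0 < δ ≤ δ₀ ≤ 1/3`, `320·m·K₁·δ₀ ≤ 1` (`m = (d+3)L`), approximate one-step lifts with gain `λ + (Cq+1)δ₀` and accuracy `Ca·δ²` (standing range). -/
theorem approxLiftStep_of_kernel_lineNeutral (hj : j + 1 ≤ P.m + P.K) {R : ℕ}
    {kz : Fin P.d → (Fin P.d → Fin P.L) → Orient P.d → (Fin P.d → Fin (2 * R + 1)) → ℝ} {K₁ lam β : ℝ}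
    (hN : LineNeutral (n := Fin 2) R kz) (hK : RowMass R kz K₁) (hRB : RowBound (Fin 2) R kz lam β) (hK0 : 0 ≤ K₁)
    (hlam : 0 ≤ lam) (hβ : 0 ≤ β) {δ₀ δ : ℝ} (hδ : 0 < δ) (hδδ₀ : δ ≤ δ₀) (hδ₀ : δ₀ ≤ 1 / 3)
    (hKδ₀ : 320 * (legLen P : ℝ) * K₁ * δ₀ ≤ 1) :
    ApproxLiftStep P j (lam + (Cq P R lam β K₁ + 1) * δ₀) (Ca P R K₁ * δ ^ 2) δ := by
  have hδ3 : δ ≤ 1 / 3 := hδδ₀.trans hδ₀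
  have m1 : (1 : ℝ) ≤ legLen P := by
    have : 1 ≤ legLen P := le_trans P.L_pos (Nat.le_mul_of_pos_left _ (by omega))
    exact_mod_cast this
  have hmK : 0 ≤ (legLen P : ℝ) * K₁ := by positivity
  have hKδ : 320 * (legLen P : ℝ) * K₁ * δ ≤ 1 := by nlinarith
  have hKδ₀' : 16 * (K₁ * δ₀) ≤ 1 / 20 := by nlinarith [mul_nonneg hK0 (hδ.le.trans hδδ₀)]
  have hs1 : K₁ * (2 * δ) ≤ 1 := by nlinarith [mul_nonneg hK0 hδ.le]
  have hπ : Fintype.card (Fin 2) * δ < Real.pi := by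
    rw [Fintype.card_fin]; have := Real.pi_gt_three; push_cast; nlinarith
  -- the plaquette clause, exactly as in the fleet's assembly (face support is not used there)
  have hplaq : ∀ V : GaugeField P (j + 1) (Matrix.specialUnitaryGroup (Fin 2) ℂ), PlaqSmall δ V →
      PlaqSmall ((lam + (Cq P R lam β K₁ + 1) * δ₀) * δ) (kernelLift R kz V) := fun V hV p => by
    have h := dist1_plaqHol_kernelLift_le (n := Fin 2) hj hK hRB hδ hV hδ3 hπ hs1 p
    have hb := plaqBound_le_budget P R hlam hβ hK0 hδ hδδ₀ (hδ₀.trans (by norm_num)) hKδ₀'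
    have hpos : 0 < δ₀ * δ := mul_pos (lt_of_lt_of_le hδ hδδ₀) hδ
    calc dist1 (GaugeField.plaqHol (kernelLift R kz V) p) ≤ lam * δ + Cq P R lam β K₁ * δ₀ * δ := h.trans hb
      _ < lam * δ + Cq P R lam β K₁ * δ₀ * δ + δ₀ * δ := lt_add_of_pos_right _ hpos
      _ = (lam + (Cq P R lam β K₁ + 1) * δ₀) * δ := by ring
  have h := approxLiftStep_of_lineNeutral hj hK hN hδ.le hδ3 hKδ hplaq
  have hC : (477 * (4 * (legLen P : ℝ) * K₁) ^ 2 +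
        (P.L : ℝ) * (8 * K₁ ^ 2 + K₁ * (((4 + P.d * R + P.d * (R + 1) : ℕ) : ℝ) ^ 2))) * δ ^ 2 = Ca P R K₁ * δ ^ 2 := by
    unfold Ca uq; ring
  rw [hC] at h
  exact h

/-- **`ApproxSmallLift` FROM A LINE-NEUTRAL KERNEL FOR A FAMILY**: a table over the family's block size with `LineNeutral ∧ RowMass K₁ ∧ RowBound λ β`
at every run gives `ApproxSmallLift F (λ + (Cq+1)δ₀) Ca δ₀` (`0 < δ₀ ≤ 1/3`, `320·6L·K₁·δ₀ ≤ 1`). -/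
theorem approxSmallLift_of_kernel_lineNeutral (F : T3Family) {R : ℕ}
    (kz : Fin 3 → (Fin 3 → Fin F.L) → Orient 3 → (Fin 3 → Fin (2 * R + 1)) → ℝ) {K₁ lam β : ℝ}
    (h : ∀ K, LineNeutral (P := F.P K) (n := Fin 2) R kz ∧ RowMass (P := F.P K) R kz K₁ ∧ RowBound (P := F.P K) (Fin 2) R kz lam β)
    (hK0 : 0 ≤ K₁) (hlam : 0 ≤ lam) (hβ : 0 ≤ β) {δ₀ : ℝ} (hδ₀ : δ₀ ≤ 1 / 3)
    (hKδ₀ : 320 * (legLen (F.P 0) : ℝ) * K₁ * δ₀ ≤ 1) :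
    ApproxSmallLift F (lam + (Cq (F.P 0) R lam β K₁ + 1) * δ₀) (Ca (F.P 0) R K₁) δ₀ := by
  intro K j hj δ hδ hδδ₀
  obtain ⟨hN, hK, hRB⟩ := h K
  have hCq : Cq (F.P K) R lam β K₁ = Cq (F.P 0) R lam β K₁ := rfl
  have hCa : Ca (F.P K) R K₁ = Ca (F.P 0) R K₁ := rfl
  have hm : (legLen (F.P K) : ℝ) = (legLen (F.P 0) : ℝ) := rfl
  have := approxLiftStep_of_kernel_lineNeutral hj hN hK hRB hK0 hlam hβ hδ hδδ₀ hδ₀ (by rw [hm]; exact hKδ₀)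
  rw [hCq, hCa] at this
  exact this

/-! ## §3 The per-`L` clause of the registered stub from a line-neutral kernel -/

/-- `legLen` of a family's run is `6L`. -/
theorem legLen_family (F : T3Family) (K : ℕ) : legLen (F.P K) = 6 * F.L := by
  show (3 + 3) * F.L = 6 * F.L
  rfl

/-- **THE PER-`L` CLAUSE FROM A LINE-NEUTRAL KERNEL WITH `λ√L < 1`** (interior-supported twin of `exists_approxSmallLift_of_kernel`): if some table over
`Fin 3 → Fin L` (given for every family of block size `L`) satisfies `LineNeutral ∧ RowMass K₁ ∧ RowBound λ β` at every run with `K₁, λ, β ≥ 0`,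
`λ√L < 1`, and the families' second-order constants are uniformly bounded (`Cq ≤ Cq₀`, `Ca ≤ Ca₀`), then
`∃ κ₀ C δ₀, 0 ≤ κ₀ ∧ κ₀√L < 1 ∧ 0 ≤ C ∧ 0 < δ₀ ∧ ∀ F, F.L = L → ApproxSmallLift F κ₀ C δ₀`. -/
theorem exists_approxSmallLift_of_kernel_lineNeutral (L : ℕ) (R : ℕ)
    (tab : (F : T3Family) → Fin 3 → (Fin 3 → Fin F.L) → Orient 3 → (Fin 3 → Fin (2 * R + 1)) → ℝ)
    {K₁ lam β Cq₀ Ca₀ : ℝ} (hK0 : 0 ≤ K₁) (hlam : 0 ≤ lam) (hβ : 0 ≤ β) (hgain : lam * Real.sqrt L < 1) (hCq₀ : 0 ≤ Cq₀) (hCa₀ : 0 ≤ Ca₀)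
    (h : ∀ F : T3Family, F.L = L → (Cq (F.P 0) R lam β K₁ ≤ Cq₀) ∧ (Ca (F.P 0) R K₁ ≤ Ca₀) ∧ ∀ K,
      LineNeutral (P := F.P K) (n := Fin 2) R (tab F) ∧ RowMass (P := F.P K) R (tab F) K₁ ∧ RowBound (P := F.P K) (Fin 2) R (tab F) lam β) :
    ∃ κ₀ C δ₀ : ℝ, 0 ≤ κ₀ ∧ κ₀ * Real.sqrt L < 1 ∧ 0 ≤ C ∧ 0 < δ₀ ∧ ∀ F : T3Family, F.L = L → ApproxSmallLift F κ₀ C δ₀ := by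
  set sL : ℝ := Real.sqrt L with hsL
  have hsL0 : 0 ≤ sL := Real.sqrt_nonneg _
  have hgap : 0 < 1 - lam * sL := by linarith
  -- the radius
  set A : ℝ := 320 * ((6 * L : ℕ) : ℝ) * K₁ + 1 with hA_def
  have hA : 0 < A := by positivity
  set δ₀ : ℝ := min (min (1 / 3) (1 / A)) ((1 - lam * sL) / (2 * ((Cq₀ + 1) * sL + 1))) with hδ₀
  have hB : 0 < 2 * ((Cq₀ + 1) * sL + 1) := by positivity
  have hδ₀pos : 0 < δ₀ := lt_min (lt_min (by norm_num) (by positivity)) (div_pos hgap hB)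
  have hδ₀3 : δ₀ ≤ 1 / 3 := (min_le_left _ _).trans (min_le_left _ _)
  have hδ₀A : δ₀ ≤ 1 / A := (min_le_left _ _).trans (min_le_right _ _)
  have hδ₀g : δ₀ ≤ (1 - lam * sL) / (2 * ((Cq₀ + 1) * sL + 1)) := min_le_right _ _
  have hKδ₀ : 320 * ((6 * L : ℕ) : ℝ) * K₁ * δ₀ ≤ 1 := by
    have h1 := (le_div_iff₀ hA).mp hδ₀A
    rw [hA_def] at h1
    nlinarith [mul_nonneg (mul_nonneg (by positivity : (0 : ℝ) ≤ 320 * ((6 * L : ℕ) : ℝ)) hK0) hδ₀pos.le]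
  refine ⟨lam + (Cq₀ + 1) * δ₀, Ca₀, δ₀, by positivity, ?_, hCa₀, hδ₀pos, fun F hFL => ?_⟩
  · have := (le_div_iff₀ hB).mp hδ₀g
    nlinarith
  · obtain ⟨hC, hCa, hK⟩ := h F hFL
    have hm : 320 * (legLen (F.P 0) : ℝ) * K₁ * δ₀ ≤ 1 := by
      rw [legLen_family, hFL]; exact hKδ₀
    have happ := approxSmallLift_of_kernel_lineNeutral F (tab F) hK hK0 hlam hβ hδ₀3 hm
    -- monotonicity of the schema in the gain and in the accuracy constant
    intro K j hj δ hδ hδδ₀ V hV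
    obtain ⟨U, hU, hacc⟩ := happ K j hj δ hδ hδδ₀ V hV
    refine ⟨U, fun p => (hU p).trans_le ?_, fun c => (hacc c).trans ?_⟩
    · have : (lam + (Cq (F.P 0) R lam β K₁ + 1) * δ₀) ≤ lam + (Cq₀ + 1) * δ₀ := by nlinarith
      exact mul_le_mul_of_nonneg_right this hδ.le
    · exact mul_le_mul_of_nonneg_right hCa (sq_nonneg _)

end Summit.QuantumFields.YangMills.Theorems.ApproxLift

end
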